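import Summits.CriticalPhenomena.PercolationContinuityZ3.Theorems.SahiMasterFamilyCyclicCore
import HarnessLib

/-!
# Minor domination (`MD₃`) for increasing triples in the CYCLIC class — sections of `…CyclicCore`

Unit `prim-master-conj` (crux anchor stmt-CriticalPhenomena-4575, helper work), gen 30; memo `run/shared/lean/prim/prim-l12/prim-master-conj/POINTWISE.md` §31.9.
`sahiE_le_mixC2_of_cycCore` applied to the `e`-sections of an increasing triple `U` with the class containments between `U_i^{e←0}` and `U_j^{e←1}`:
`Λ_e(U) ≥ 0`, hence (gen 19's `sahiE_three_ge_sq_minors_of_mixC2_ge`) `(1−p_e)²E₃(U^{e←0}) + p_e²E₃(U^{e←1}) ≤ E₃(U)`, and the settledness transfer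
(C₃ passes up from the two minors, zeros pass down). [this work]
-/

noncomputable section

open scoped Classical

namespace Summit.CriticalPhenomena.PercolationContinuityZ3.Theorems

open Finset Function
open Literature.Combinatorics.Sahi2008
open Literature.Probability.Percolation.DecisionTree (ind)
open SahiCombMix

namespace Pointwise

variable {ι : Type} [Fintype ι]

/-! ### Sections of an increasing triple: minor domination on the cyclic class -/

section Sections

variable (p : ι → unitInterval) (e : ι) (U : Fin 3 → Set (Set ι)) (hU : ∀ j, IsUpperSet (U j))
  (h01 : secAt e false (U 0) ⊆ secAt e true (U 1)) (h12 : secAt e false (U 1) ⊆ secAt e true (U 2))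
  (h20 : secAt e false (U 2) ⊆ secAt e true (U 0))
include hU h01 h12 h20

/-- **`Λ_e(U) ≥ 0` and `MD₃` on the cyclic class**: for an increasing triple `U` with `U_0^{e←0} ⊆ U_1^{e←1}`, `U_1^{e←0} ⊆ U_2^{e←1}`,
`U_2^{e←0} ⊆ U_0^{e←1}`: (i) `0 ≤ mixC2(U^{e←0}, U^{e←1}) − E₃(μ_p;U^{e←1})` (`sahiE_le_mixC2_of_cycCore` for the sections) and (ii) hence, by
gen 19's `sahiE_three_ge_sq_minors_of_mixC2_ge`, minor domination with the explicit constants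
`p_e²·E₃(μ_p;U^{e←1}) + (1−p_e)²·E₃(μ_p;U^{e←0}) ≤ E₃(μ_p;U)`. [this work] -/
theorem mixC2_sub_sahiE_nonneg_and_sq_minors_le_of_cycCore :
    0 ≤ mixC2 (bernoulliWeight p) (fun j => secAt e false (U j)) (fun j => secAt e true (U j))
        - sahiE (bernoulliWeight p) 3 (fun j => ind (secAt e true (U j))) ∧
      (p e : ℝ) ^ 2 * sahiE (bernoulliWeight p) 3 (fun j => ind (secAt e true (U j)))
          + (1 - (p e : ℝ)) ^ 2 * sahiE (bernoulliWeight p) 3 (fun j => ind (secAt e false (U j)))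
        ≤ sahiE (bernoulliWeight p) 3 (fun j => ind (U j)) := by
  have hΛ : 0 ≤ mixC2 (bernoulliWeight p) (fun j => secAt e false (U j)) (fun j => secAt e true (U j))
      - sahiE (bernoulliWeight p) 3 (fun j => ind (secAt e true (U j))) :=
    sahiE_le_mixC2_of_cycCore p (fun j => secAt e false (U j)) (fun j => secAt e true (U j))
      (fun j => isUpperSet_secAt e true (hU j)) (fun j => isUpperSet_secAt e false (hU j))
      (fun j => RigidityAll.secAt_false_subset_secAt_true e (hU j)) h01 h12 h20
  have hMD := sahiE_three_ge_sq_minors_of_mixC2_ge e U hU p (by linarith)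
  exact ⟨hΛ, by linarith⟩

/-- **Settledness transfer on the cyclic class**: if `E₃(μ_p;U) = 0` then `E₃(μ_p;U^{e←0}) = 0` provided `p_e ≠ 1` and `E₃(μ_p;U^{e←1}) = 0`
provided `p_e ≠ 0` (given both minors `≥ 0`), and `E₃(μ_p;U) ≥ 0` whenever both `e`-minors are `≥ 0`. [this work] -/
theorem minors_eq_zero_and_sahiE_three_nonneg_of_cycCore
    (h0 : 0 ≤ sahiE (bernoulliWeight p) 3 (fun j => ind (secAt e false (U j))))
    (h1 : 0 ≤ sahiE (bernoulliWeight p) 3 (fun j => ind (secAt e true (U j)))) :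
    ((p e : ℝ) ≠ 1 → sahiE (bernoulliWeight p) 3 (fun j => ind (U j)) = 0 →
        sahiE (bernoulliWeight p) 3 (fun j => ind (secAt e false (U j))) = 0) ∧
      ((p e : ℝ) ≠ 0 → sahiE (bernoulliWeight p) 3 (fun j => ind (U j)) = 0 →
        sahiE (bernoulliWeight p) 3 (fun j => ind (secAt e true (U j))) = 0) ∧
      0 ≤ sahiE (bernoulliWeight p) 3 (fun j => ind (U j)) := by
  have h := (mixC2_sub_sahiE_nonneg_and_sq_minors_le_of_cycCore p e U hU h01 h12 h20).2
  have a0 := mul_nonneg (sq_nonneg (1 - (p e : ℝ))) h0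
  have a1 := mul_nonneg (sq_nonneg (p e : ℝ)) h1
  refine ⟨fun hpe hE => ?_, fun hpe hE => ?_, by linarith⟩
  · rw [hE] at h
    have hne : (1 - (p e : ℝ)) ≠ 0 := sub_ne_zero.2 (Ne.symm hpe)
    have hsq : 0 < (1 - (p e : ℝ)) ^ 2 := by positivity
    have hz : (1 - (p e : ℝ)) ^ 2 * sahiE (bernoulliWeight p) 3 (fun j => ind (secAt e false (U j))) = 0 := by linarith
    rcases mul_eq_zero.1 hz with h' | h'
    · exact absurd h' (ne_of_gt hsq)
    · exact h'
  · rw [hE] at h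
    have hsq : 0 < (p e : ℝ) ^ 2 := by positivity
    have hz : (p e : ℝ) ^ 2 * sahiE (bernoulliWeight p) 3 (fun j => ind (secAt e true (U j))) = 0 := by linarith
    rcases mul_eq_zero.1 hz with h' | h'
    · exact absurd h' (ne_of_gt hsq)
    · exact h'

end Sections

end Pointwise

end Summit.CriticalPhenomena.PercolationContinuityZ3.Theorems
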